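import Literature.Analysis.FluidPDE.PassiveScalarDiagMildSourceDuhamel
import Literature.Analysis.FluidPDE.PassiveScalarDiagMildWeakForm
import HarnessLib

/-!
# Mild (Duhamel) formulation of the passive scalar equation with constant diagonal diffusion and
  bounded drift: a FORCED mild solution is a weak solution

Analysis/FluidPDE proof-support file (everything proved). The forced twin of
`PassiveScalarDiagMildWeakForm`: if an `L^∞_t L²_x` field `θ` on `[0,T]` with time-continuous
Fourier coefficients satisfies the undamped FORCED mild equation
`𝓕(θ(t))(k) = e^{-νₖt} θ̂₀(k) + ∫_{(0,t]} e^{-νₖ(t-τ)} ŝ(τ)(k) dτ - ∫_{(0,t]} e^{-νₖ(t-τ)} N(θ)(τ)(k) dτ`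
(`νₖ = 4π²κ∑ᵢaᵢkᵢ²`, `N(θ) = 𝓕(div(uθ))`, source `s ∈ L²((0,T) × T^d)` of `PassiveScalarDiagMildSource`),
then `θ` satisfies the weak formulation of `∂ₜθ + u·∇θ = κ∑ᵢaᵢ∂ᵢ∂ᵢθ + s`, `θ(0) = θ₀` against every
space–time test function on `T^d × [0,T)` (`Torus.weak_eq_of_forcedMild`): Parseval slice by slice
for `θ` AND for the source pairing `∫ s(t)ψ(t) = ∑ₖ ŝ(t)(k) conj ψ̂(t)(k)`, exchange of the mode sums
with the time integral, and the per-mode identity `mild_mode_weak_identity` of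
`PassiveScalarDiagMildWeakMode` applied with the forcing `N(θ) - ŝ` (Pazy 1983, Ch. 4 §4.2: mild
solutions of the inhomogeneous problem are weak solutions).

## References

* A. Pazy, *Semigroups of Linear Operators and Applications to PDE*, Springer 1983, Ch. 4 §4.2,
  Def. 2.3–Cor. 2.5 (mild solutions of the inhomogeneous initial value problem).
* L. C. Evans, *Partial Differential Equations*, 2nd ed. (AMS 2010), §7.1.1–7.1.2.
* L. Grafakos, *Classical Fourier Analysis*, 3rd ed. (2014), Prop. 3.2.7 (3), §3.3.1.
-/

noncomputable section

open MeasureTheory TopologicalSpace Set Function Filter UnitAddTorus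
open _root_.Topology
open scoped ENNReal NNReal InnerProductSpace ComplexConjugate

namespace Literature.Analysis.FluidPDE

namespace Torus

open Literature.Analysis.FunctionSpaces.Torus Literature.Analysis.FunctionSpaces

variable {d : Type*} [Fintype d]

/-! ## Mild ⇒ weak for the FORCED equation: the weak formulation of a forced mild solution -/

section ForcedWeakForm

variable [DecidableEq d]
variable {T U E Es κ : ℝ} {a : d → ℝ} {u : ℝ → UnitAddTorus d → EuclideanSpace ℝ d}
  {θ : ℝ → UnitAddTorus d → ℝ} {θ₀ : UnitAddTorus d → ℝ} {s ψ : ℝ → UnitAddTorus d → ℝ}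

omit [DecidableEq d] in
/-- `|ŝ(τ)(k)| ≤ ∫ |s(τ)|` for an integrable slice (the characters have modulus one). [cite: Grafakos2014, Prop. 3.2.7 (3)] -/
theorem norm_testCoeff_le_integral_abs {τ : ℝ} (hs : Integrable (s τ) (volume : Measure (UnitAddTorus d)))
    (k : d → ℤ) : ‖testCoeff s τ k‖ ≤ ∫ x, |s τ x| := by
  rw [testCoeff_apply, mFourierCoeff_eq_integral_volume]
  refine (norm_integral_le_integral_norm _).trans ?_
  refine integral_mono_of_nonneg (ae_of_all _ fun x => norm_nonneg _) hs.abs (ae_of_all _ fun x => ?_)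
  dsimp only
  rw [norm_smul, norm_mFourier_apply, one_mul, Complex.norm_real, Real.norm_eq_abs]

omit [DecidableEq d] in
/-- The slice `L¹` norms `τ ↦ ∫ |s(τ)|` are integrable on `(0,T)`. [cite: Evans2010, §7.1.1 (f ∈ L²(0,T;L²(U))), §7.1.2 Thm. 2] -/
theorem SourceL2.integrable_integral_abs (h : SourceL2 T s Es) :
    Integrable (fun τ => ∫ x, |s τ x|) ((volume : Measure ℝ).restrict (Ioo 0 T)) := by
  have h1 := h.integrable_uncurry.norm.integral_prod_left
  refine h1.congr (ae_of_all _ fun τ => ?_)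
  rfl

omit [DecidableEq d] in
/-- Almost every slice of the source is integrable. [cite: Evans2010, §7.1.1 (f ∈ L²(0,T;L²(U))), §7.1.2 Thm. 2] -/
theorem SourceL2.ae_integrable_slice (h : SourceL2 T s Es) :
    ∀ᵐ τ ∂((volume : Measure ℝ).restrict (Ioo 0 T)), Integrable (s τ) (volume : Measure (UnitAddTorus d)) := by
  filter_upwards [h.ae_memLp_slice] with τ hτ
  exact hτ.integrable one_le_two

/-- **The source pairing, mode by mode**: `t ↦ ŝ(t)(k) conj(ψ̂(t)(k))` is integrable on `(0,T)`
and the `L¹` norms are summable over `k` (decay of every order of the test coefficients against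
`|ŝ(t)(k)| ≤ ‖s(t)‖_{L¹}`). [cite: Grafakos2014, §3.3.1] -/
theorem integrable_testCoeff_source_mul_and_summable (hT : 0 < T) (hs : SourceL2 T s Es)
    (hψ : IsSpaceTimeTest T ψ) :
    (∀ k, Integrable (fun t => testCoeff s t k * conj (testCoeff ψ t k)) ((volume : Measure ℝ).restrict (Ioo 0 T))) ∧
      Summable fun k => ∫ t in Ioo 0 T, ‖testCoeff s t k * conj (testCoeff ψ t k)‖ := by
  set L := ScalarFourier.latOrder d with hL
  obtain ⟨C₀, hC₀, hφ⟩ := exists_hasDecay_testCoeff hT hψ L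
  have hbound : ∀ k, ∀ᵐ t ∂((volume : Measure ℝ).restrict (Ioo 0 T)),
      ‖testCoeff s t k * conj (testCoeff ψ t k)‖ ≤ C₀ * ((1 + ‖k‖) ^ L)⁻¹ * ∫ x, |s t x| := by
    intro k
    filter_upwards [hs.ae_integrable_slice, ae_restrict_mem measurableSet_Ioo] with t ht htI
    rw [norm_mul, Complex.norm_conj, mul_comm]
    exact mul_le_mul (hφ t (Ioo_subset_Icc_self htI) k) (norm_testCoeff_le_integral_abs ht k) (norm_nonneg _)
      (by positivity)
  have hint : ∀ k, Integrable (fun t => testCoeff s t k * conj (testCoeff ψ t k))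
      ((volume : Measure ℝ).restrict (Ioo 0 T)) := by
    intro k
    refine Integrable.mono' ((hs.integrable_integral_abs).const_mul (C₀ * ((1 + ‖k‖) ^ L)⁻¹)) ?_ (hbound k)
    exact (integrable_testCoeff_source hs k).aestronglyMeasurable.mul
      (Complex.continuous_conj.comp (continuous_testCoeff hψ k)).aestronglyMeasurable
  refine ⟨hint, ?_⟩
  refine Summable.of_nonneg_of_le (fun k => integral_nonneg fun t => norm_nonneg _) (fun k => ?_)
    ((ScalarFourier.summable_latWeight (d := d)).mul_left (C₀ * ∫ t in Ioo 0 T, ∫ x, |s t x|))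
  calc ∫ t in Ioo 0 T, ‖testCoeff s t k * conj (testCoeff ψ t k)‖
      ≤ ∫ t in Ioo 0 T, C₀ * ((1 + ‖k‖) ^ L)⁻¹ * ∫ x, |s t x| :=
        integral_mono_ae (hint k).norm ((hs.integrable_integral_abs).const_mul _) (hbound k)
    _ = C₀ * (∫ t in Ioo 0 T, ∫ x, |s t x|) * ((1 + ‖k‖) ^ L)⁻¹ := by
        rw [integral_const_mul]; ring

omit [DecidableEq d] in
/-- **The slice Parseval identity for the source pairing**: for a.e. `t ∈ (0,T)`,
`∑ₖ ŝ(t)(k) conj(ψ̂(t)(k)) = ∫ s(t) ψ(t)`. [cite: Grafakos2014, Prop. 3.2.7 (3)] -/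
theorem ae_hasSum_testCoeff_source_mul (hs : SourceL2 T s Es) (hψ : IsSpaceTimeTest T ψ) :
    ∀ᵐ t ∂((volume : Measure ℝ).restrict (Ioo 0 T)),
      HasSum (fun k => testCoeff s t k * conj (testCoeff ψ t k)) (((∫ x, s t x * ψ t x : ℝ) : ℂ)) := by
  filter_upwards [hs.ae_memLp_slice] with t ht
  have h := hasSum_conj_mul_mFourierCoeff_ofReal ht ((hψ.isSmooth_slice t).memLp 2)
  simp only [testCoeff_apply]
  exact h.congr_fun fun k => mul_comm _ _

/-- **A forced mild solution is a weak solution (the weak formulation).** Let `θ` be an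
`L^∞_t L²_x` field on `[0,T]` with time-continuous Fourier coefficients satisfying the (undamped)
FORCED mild equation
`𝓕(θ(t))(k) = e^{-νₖt} θ̂₀(k) + ∫_{(0,t]} e^{-νₖ(t-τ)} ŝ(τ)(k) dτ - ∫_{(0,t]} e^{-νₖ(t-τ)} N(θ)(τ)(k) dτ`
on `[0,T]`, for a bounded drift, `κ ≥ 0`, `aᵢ > 0`, `θ₀ ∈ L²` and a source `s ∈ L²((0,T) × T^d)`.
Then for every space–time test function `ψ` on `T^d × [0,T)`,
`∫₀ᵀ ∫ θ (∂ₜψ + u·∇ψ + κ ∑ᵢ aᵢ ∂ᵢ∂ᵢψ) + ∫₀ᵀ ∫ s ψ + ∫ θ₀ ψ(0) = 0` (Parseval slice by slice,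
exchange of the mode sum with the time integral, and the per-mode identity
`mild_mode_weak_identity` with the forcing `N(θ) - ŝ`; Pazy 1983, Ch. 4 §4.2: mild solutions of
the inhomogeneous problem are weak solutions). [cite: Pazy1983, Ch. 4 §4.2, Def. 2.3–Cor. 2.5, pp. 106–108] -/
theorem weak_eq_of_forcedMild (hT : 0 < T) (hκ : 0 ≤ κ) (ha : ∀ i, 0 < a i) (hu : DriftBound T u U)
    (hθ : IsL2Field T E θ) (hθ₀ : MemLp θ₀ 2 volume) (hs : SourceL2 T s Es)
    (hcont : ∀ k, ContinuousOn (fun t => mFourierCoeff (fun x => (θ t x : ℂ)) k) (Icc 0 T))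
    (hmild : ∀ t ∈ Icc 0 T, ∀ k, mFourierCoeff (fun x => (θ t x : ℂ)) k =
      mildMap κ a 0 u θ₀ θ t k + sourceDuhamel κ a 0 s t k)
    (hψ : IsSpaceTimeTest T ψ) :
    (∫ t in Ioo 0 T, ∫ x, θ t x *
        (FunctionSpaces.Torus.timeDeriv ψ t x + ⟪u t x, FunctionSpaces.Torus.gradient (ψ t) x⟫_ℝ +
          κ * ∑ i, a i * FunctionSpaces.Torus.partialDeriv i (FunctionSpaces.Torus.partialDeriv i (ψ t)) x)) +
      (∫ t in Ioo 0 T, ∫ x, s t x * ψ t x) +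
      ∫ x, θ₀ x * ψ 0 x = 0 := by
  obtain ⟨hint, hsum⟩ := integrable_modeIntegrand_and_summable hT hκ ha hu hθ hcont hψ
  obtain ⟨hintS, hsumS⟩ := integrable_testCoeff_source_mul_and_summable hT hs hψ
  obtain ⟨T', hT'T, hψ0⟩ := exists_testCoeff_eq_zero hψ
  -- (1) the space–time pairing of `θ` as a sum over the modes
  have h1 : (((∫ t in Ioo 0 T, ∫ x, θ t x *
        (FunctionSpaces.Torus.timeDeriv ψ t x + ⟪u t x, FunctionSpaces.Torus.gradient (ψ t) x⟫_ℝ +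
          κ * ∑ i, a i * FunctionSpaces.Torus.partialDeriv i (FunctionSpaces.Torus.partialDeriv i (ψ t)) x) : ℝ) : ℂ)) =
      ∑' k, ∫ t in Ioo 0 T, modeIntegrand κ a u θ ψ t k := by
    rw [← integral_complex_ofReal, integral_tsum_of_summable_integral_norm hint hsum]
    refine integral_congr_ae ?_
    filter_upwards [ae_hasSum_modeIntegrand (κ := κ) (a := a) hu hθ hψ] with t ht
    exact ht.tsum_eq.symm
  -- (1') the space–time pairing of `s` as a sum over the modes
  have h1S : (((∫ t in Ioo 0 T, ∫ x, s t x * ψ t x : ℝ) : ℂ)) =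
      ∑' k, ∫ t in Ioo 0 T, testCoeff s t k * conj (testCoeff ψ t k) := by
    rw [← integral_complex_ofReal, integral_tsum_of_summable_integral_norm hintS hsumS]
    refine integral_congr_ae ?_
    filter_upwards [ae_hasSum_testCoeff_source_mul hs hψ] with t ht
    exact ht.tsum_eq.symm
  -- (2) per mode: `∫ f_k + ∫ ŝ_k conj ψ̂_k = -θ̂₀(k) conj(ψ̂(0)(k))`
  have h2 : ∀ k, (∫ t in Ioo 0 T, modeIntegrand κ a u θ ψ t k) +
      (∫ t in Ioo 0 T, testCoeff s t k * conj (testCoeff ψ t k)) =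
      -(mFourierCoeff (fun x => (θ₀ x : ℂ)) k * conj (testCoeff ψ 0 k)) := by
    intro k
    have hφd : ∀ t, HasDerivAt (fun s => conj (testCoeff ψ s k))
        (conj (testCoeff (FunctionSpaces.Torus.timeDeriv ψ) t k)) t := fun t =>
      hasDerivAt_conj_comp (hasDerivAt_testCoeff hψ t k)
    have hφ'c : Continuous fun t => conj (testCoeff (FunctionSpaces.Torus.timeDeriv ψ) t k) :=
      Complex.continuous_conj.comp (continuous_testCoeff hψ.timeDeriv k)
    have hφ0' : ∀ t, T' ≤ t → conj (testCoeff ψ t k) = 0 := fun t ht => by rw [hψ0 t ht k, map_zero]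
    have hN : IntegrableOn (fun t => transportCoeff u θ t k - testCoeff s t k) (Ioo 0 T) :=
      (integrable_transportCoeff hu hθ k).sub (integrable_testCoeff_source hs k)
    have hc : ∀ t ∈ Icc 0 T, mFourierCoeff (fun x => (θ t x : ℂ)) k =
        ((Real.exp (-(diagRate κ a k * t)) : ℝ) : ℂ) * mFourierCoeff (fun x => (θ₀ x : ℂ)) k -
          ∫ τ in Ioc 0 t, ((Real.exp (-(diagRate κ a k * (t - τ))) : ℝ) : ℂ) *
            (transportCoeff u θ τ k - testCoeff s τ k) := by
      intro t ht
      have hi1 := integrableOn_kernel_mul_transportCoeff (κ := κ) (a := a) (lam := 0) hu hθ ht.2 k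
      have hi2 := integrableOn_kernel_mul_testCoeff (κ := κ) (a := a) (lam := 0) hs ht.2 k
      simp only [add_zero] at hi1 hi2
      rw [hmild t ht k, mildMap_apply, duhamelCoeff_apply, sourceDuhamel_apply]
      simp only [add_zero]
      have e3 : (∫ τ in Ioc 0 t, ((Real.exp (-(diagRate κ a k * (t - τ))) : ℝ) : ℂ) *
          (transportCoeff u θ τ k - testCoeff s τ k)) =
          (∫ τ in Ioc 0 t, ((Real.exp (-(diagRate κ a k * (t - τ))) : ℝ) : ℂ) * transportCoeff u θ τ k) -
            ∫ τ in Ioc 0 t, ((Real.exp (-(diagRate κ a k * (t - τ))) : ℝ) : ℂ) * testCoeff s τ k := by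
        rw [← integral_sub hi1 hi2]
        refine integral_congr_ae (ae_of_all _ fun τ => ?_)
        dsimp only
        rw [mul_sub]
      rw [e3]
      ring
    have key := mild_mode_weak_identity hT hN hc hφd hφ'c hT'T hφ0'
    have e : (fun t => modeIntegrand κ a u θ ψ t k) = fun t =>
        mFourierCoeff (fun x => (θ t x : ℂ)) k * conj (testCoeff (FunctionSpaces.Torus.timeDeriv ψ) t k) -
          diagRate κ a k * mFourierCoeff (fun x => (θ t x : ℂ)) k * conj (testCoeff ψ t k) -
          transportCoeff u θ t k * conj (testCoeff ψ t k) := by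
      funext t; rw [modeIntegrand]; ring
    -- split the identity's integral into the mode integrand and the source pairing
    have hI1 : Integrable (fun t => mFourierCoeff (fun x => (θ t x : ℂ)) k *
        conj (testCoeff (FunctionSpaces.Torus.timeDeriv ψ) t k) -
          diagRate κ a k * mFourierCoeff (fun x => (θ t x : ℂ)) k * conj (testCoeff ψ t k) -
          transportCoeff u θ t k * conj (testCoeff ψ t k)) ((volume : Measure ℝ).restrict (Ioo 0 T)) := by
      rw [← e]; exact hint k
    have esplit : (∫ t in Ioo 0 T, (mFourierCoeff (fun x => (θ t x : ℂ)) k *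
        conj (testCoeff (FunctionSpaces.Torus.timeDeriv ψ) t k) -
          diagRate κ a k * mFourierCoeff (fun x => (θ t x : ℂ)) k * conj (testCoeff ψ t k) -
          (transportCoeff u θ t k - testCoeff s t k) * conj (testCoeff ψ t k))) =
        (∫ t in Ioo 0 T, modeIntegrand κ a u θ ψ t k) +
          ∫ t in Ioo 0 T, testCoeff s t k * conj (testCoeff ψ t k) := by
      rw [e, ← integral_add hI1 (hintS k)]
      refine integral_congr_ae (ae_of_all _ fun t => ?_)
      dsimp only
      ring
    rw [← esplit]
    linear_combination key
  -- (3) the datum term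
  have H3 := hasSum_conj_mul_mFourierCoeff_ofReal hθ₀ ((hψ.isSmooth_slice 0).memLp 2)
  -- (4) combine
  have hsum1 : Summable fun k => ∫ t in Ioo 0 T, modeIntegrand κ a u θ ψ t k :=
    .of_norm_bounded hsum fun k => norm_integral_le_integral_norm _
  have hsum2 : Summable fun k => ∫ t in Ioo 0 T, testCoeff s t k * conj (testCoeff ψ t k) :=
    .of_norm_bounded hsumS fun k => norm_integral_le_integral_norm _
  have hneg : HasSum (fun k => (∫ t in Ioo 0 T, modeIntegrand κ a u θ ψ t k) +
      ∫ t in Ioo 0 T, testCoeff s t k * conj (testCoeff ψ t k)) (-(((∫ x, θ₀ x * ψ 0 x : ℝ) : ℂ))) := by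
    have h := H3.neg
    refine h.congr_fun fun k => ?_
    rw [h2 k]
    show -(mFourierCoeff (fun x => (θ₀ x : ℂ)) k * conj (testCoeff ψ 0 k)) =
      -(conj (mFourierCoeff (fun x => ((ψ 0 x : ℝ) : ℂ)) k) * mFourierCoeff (fun x => ((θ₀ x : ℝ) : ℂ)) k)
    rw [testCoeff_apply, mul_comm]
  have htot : (((∫ t in Ioo 0 T, ∫ x, θ t x *
        (FunctionSpaces.Torus.timeDeriv ψ t x + ⟪u t x, FunctionSpaces.Torus.gradient (ψ t) x⟫_ℝ +
          κ * ∑ i, a i * FunctionSpaces.Torus.partialDeriv i (FunctionSpaces.Torus.partialDeriv i (ψ t)) x) : ℝ) : ℂ)) +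
      (((∫ t in Ioo 0 T, ∫ x, s t x * ψ t x : ℝ) : ℂ)) +
      (((∫ x, θ₀ x * ψ 0 x : ℝ) : ℂ)) = 0 := by
    rw [h1, h1S, ← hsum1.tsum_add hsum2, hneg.tsum_eq]
    ring
  exact_mod_cast htot

end ForcedWeakForm

end Torus

end Literature.Analysis.FluidPDE

end
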